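import Summits.BirchSwinnertonDyer.BirchSwinnertonDyer.Theses.PlecticLegs
import Literature.Barriers.BirchSwinnertonDyer.RankNotSumOfLocalInvariantsDescentK41
import Literature.Barriers.BirchSwinnertonDyer.RankNotSumOfLocalInvariantsCNRanksA
import Literature.NumberTheory.EllipticCurves.AnalyticRankOverNumberFieldProofs
import Literature.NumberTheory.EllipticCurves.CongruentNumberCurveRootNumberEven
import Literature.NumberTheory.EllipticCurves.CongruentNumberCurveLSeriesProofs
import Literature.NumberTheory.EllipticCurves.LFunctionSmulProofs
import Literature.NumberTheory.EllipticCurves.BSDInvariantsProofs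
import Literature.NumberTheory.EllipticCurves.BSDAnalyticRankProofs
import Literature.NumberTheory.EllipticCurves.MordellWeilTheoremProofs
import Literature.NumberTheory.QuadraticFields.QuadraticDedekindZeta
import Literature.NumberTheory.QuadraticFields.SquareRootGenerator
import Literature.Barriers.BirchSwinnertonDyer.RankNotSumOfLocalInvariantsCNRanksB
import Literature.Barriers.BirchSwinnertonDyer.RankNotSumOfLocalInvariantsCNRanksC
import Literature.NumberTheory.EllipticCurves.TunnellWaldspurgerCorollaryProofs
import Literature.NumberTheory.EllipticCurves.QuadraticTwistRank
import Literature.NumberTheory.QuadraticFields.FundamentalDiscriminant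
import HarnessLib

/-!
# Disproof of `PlecticPointsLB` (stmt-BirchSwinnertonDyer-17518) — findings of the crux disprover, cycles 1–2

Seats `refuter-cdisprove-stmt-BirchSwinnertonDyer-17518-0` (gen 1, cycle 1, sections (A)–(E)) and
`refuter-cdisprove-stmt-BirchSwinnertonDyer-17518-g2-0` (gen 2, sections (F)–(H), (E) discharged modulo one numerical
fact), 2026-08-17. Route `PlecticLegs` (the item is wanted by this route only). The crux:

`PlecticPointsLB : ∀ F [NumberField F] [IsTotallyReal F] (V : WeierstrassCurve F) [V.IsElliptic],
  2 ≤ [F:ℚ] → V.analyticRank = [F:ℚ] → [F:ℚ] ≤ rank_ℤ V(F)`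

— the lower-bound half of BSD over a totally real field in the "plectic regime" `ord_{s=1} L(V/F,s) = [F:ℚ]`.

## Findings (every `theorem` below is sorry-free — v3 has NO `sorry`; prose only in docstrings)

* **(A) Load-bearing analysis.** Of the four hypotheses only the analytic one carries truth:
  - `V.analyticRank = [F:ℚ]` DROPPED ⇒ false: `plecticPointsLB_false_without_analyticRank`
    (`F = ℚ(√41)`, `V = 480a1`, `rank ≤ 1`; the tree's complete 2-descent over `ℚ(√41)`).
  - `V.analyticRank = [F:ℚ]` WEAKENED to `V.analyticRank ≠ 0` ("`L(V/F,1) = 0`") ⇒ false: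
    `plecticPointsLB_false_of_weakVanishing` (`F = ℚ(√6)`, `V = E₁ : y² = x³ − x`;
    `r_an(V/F) = r_an(E₁) + r_an(E₆) ≠ 0` by Artin formalism + `L(E₆,1) = 0` (Hecke continuation and root
    number, PROVED in tree), `rank V(F) = rank E₁(ℚ) + rank E₆(ℚ) = 0 + 1 = 1 < 2` by Mordell–Weil + the tree's
    2-descents). In truth `r_an(V/F) = 1`: one plectic direction short. So every proof must consume
    `ord_{s=1} L(V/F,s) ≥ 2` — exactly the input of a plectic (`[F:ℚ]`-th derivative) Gross–Zagier formula —
    and not merely central vanishing, parity, or the field.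
  - `IsTotallyReal F` dropped: still a consequence of BSD over number fields — NOT load-bearing for truth
    (it is load-bearing for the ENGINE: CM points on quaternionic Shimura varieties need `F` totally real).
    No `_false_without_IsTotallyReal` can exist unless BSD/K fails for some number field `K`.
  - `2 ≤ [F:ℚ]` dropped: the new case `[F:ℚ] = 1` (`F ≅ ℚ`, `r_an = 1 ⇒ rank ≥ 1`) is Gross–Zagier–Kolyvagin —
    NOT load-bearing for truth (it only separates the crux from the support item `RankLeOne`).
  - `[V.IsElliptic]` dropped: no counterexample either — for singular `V` Mathlib's minimal-model Euler
    product is a Hecke `L`-function of `F` (nodal: `∏ (1 ∓ N𝔭^{-s})^{-1}`, non-vanishing at `1` or junk `0`)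
    or `1` (cuspidal), so `V.analyticRank = 0 ≠ d` (paper analysis; nothing to prove).
* **(B) Junk audit (paper, agreeing with grounders ×5 and the birth refuter).** `analyticRank` is
  `analyticOrderNatAt entireLFunction 1`; without an entire continuation `entireLFunction = V.LSeries`, whose
  `tsum` is the junk `0` left of the abscissa of absolute convergence `3/2`, so the order is `⊤ ↦ 0`: the
  hypothesis `= d ≥ 2` EXCLUDES junk (it forces `HasEntireLFunction V` on paper, though this implication is not
  kernel-provable today — see (D), stub T). `mordellWeilRank = finrank ℤ V(F)` is honest (Mordell–Weil is PROVED
  in tree: `WeierstrassCurve.module_finite_point_holds`, axioms standard). Mathlib's `WeierstrassCurve.LFunction`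
  over a number field is the genuine Euler product over `HeightOneSpectrum (𝓞 F)` of local factors of local
  minimal models (`tprod` in the pointwise topology; Northcott + constant coefficient `1` make it non-junk).
  `Module.finrank ℚ F` is canonical (`Subsingleton (Module ℚ F)`). Verdict: no junk refutation exists; a
  counterexample to the crux is a counterexample to BSD over a totally real field, full stop.
* **(C) Strengthenings / tightness.** Natural strengthenings are all BSD/K-implied and irrefutable: all number
  fields; `analyticRank ≤ rank` in every rank; equality (= this ∧ the sibling crux `PlecticRankUB`). The only
  false weakenings are those admitting `r_an(V/F) < [F:ℚ]` — (A). Tightness (`rank = d` attained in the regime)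
  is true on paper (389a1 over any silent real quadratic field: rank `E(F) = rank E(ℚ) = 2` by Kato) but not
  kernel-certifiable: no curve has a PROVED exact analytic rank `2` in the tree (needs `L(E,1) = L'(E,1) = 0`
  exactly and `L''(E,1) ≠ 0`; the tree's only proved positive analytic ranks are `r_an(E_n) ≠ 0`, CM, odd sign).
* **(D) Targets = the three stubs of the picked line `conjugate-pigeonhole`** (skeleton sha 1df1a6c2…,
  `Lines/sketch_conjugate_pigeonhole.lean`): A `stub_factorOrders` is TRUE (pigeonhole over additivity of
  `analyticOrderAt`; the half-plane factorisation bootstraps `HasEntireLFunction`); mutation: its hypothesis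
  `0 < d` is decoration (`stub_factorOrders_vacuous_at_zero`: at `d = 0` the conclusion ranges over `Fin 0`),
  and `[NumberField F]`/`V` enter only through the term `V.entireLFunction`. B `stub_balancedChart` is TRUE and
  closable from tree theorems in ~30 lines (`analyticRankOver_eq_add_of_finrank_eq_two`,
  `analyticRank_ne_zero_of_entireLFunction_one_eq_zero`, `isElliptic_quadraticTwist`,
  `module_finite_point_holds`, `mordellWeilRank_baseChange_of_finrank_eq_two_of_finite`) — the proof of
  `plecticPointsLB_false_of_weakVanishing` below runs exactly this chain on `(E₁, ℚ(√6))`. T `stub_atlas` is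
  crux-equivalent modulo the junk lemma "`V.analyticRank ≠ 0 → V.HasEntireLFunction`" (trivial factorisation
  `g₀ = L/(s−1)^{d−1}`, `gᵢ = s − 1`), as the lead states in `PICKED.md`; it inherits the crux's immunity —
  nothing to kill. 0/3 targets broken.
* **(E) Near-miss, now discharged modulo ONE printed numerical fact (gen 2).** `hypotheses_satisfiable_d2`
  — the regime is inhabited at `d = 2` — was a `sorry` in v1–v2 (389a1 over silent `ℚ(√m)`, kit j024213, no
  exact analytic rank `2` in tree). v3 proves it from `r_an(E₂₆₅) = 2` (equivalently BSD(RANK) at the single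
  CM curve `E₂₆₅ : y² = x³ − 265²x`, whose rank `2` IS certified in tree): witness `E₁/ℚ(√265)`, see (F).
* **(F) Tightness and inhabitation (gen 2; landing as `Theorems/PlecticPointsLB/Negative/
  PlecticPointsLBTightness.lean`).** New certified exact data found in the tree: `L(E_n,1) ≠ 0` PROVED for
  `n ∈ {1,2,3,10}` (Tunnell–Waldspurger corollary file: `r_an(E₁) = 0`), `2`-descent ranks `E₂₆₅ = 2`,
  `E₁₅₉₀ = 1` (CNRanksB/C), and over `K = ℚ(√265)` (fundamental discriminant `265`) the twists are LITERAL: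
  `E₆^{(265)} = E₁₅₉₀`, `E₁^{(265)} = E₂₆₅`. Hence, sorry-free:
  - `exists_weakRegime_rank_eq_degree`: `E₆/K` has `r_an ≥ 1 + 1 = 2 = [K:ℚ]` and rank EXACTLY `2`
    (balanced chart) ⇒ `plecticPointsLB_bound_not_strict_weak`: **unconditionally, `d ≤ rank` cannot be
    improved to `d < rank` from `ord ≥ d`** — the bound of the crux is sharp.
  - `exists_silentBaseChange_rank_eq_degree`: `E₁/K` has rank `0 + 2 = 2 = [K:ℚ]` and
    `r_an(E₁/K) = r_an(E₂₆₅)` EXACTLY — the route's own configuration (unbalanced silent base change of a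
    rank-two curve) with everything but `r_an(E₂₆₅)` certified ⇒ `regime_inhabited_rank_eq_of_analyticRank_265`
    / `_of_BSD` (non-vacuity modulo BSD at `E₂₆₅`) and `plecticPointsLB_bound_not_strict_of_analyticRank_265`
    (tightness of the EXACT crux modulo the same fact).
  - `plecticPointsLB_false_at_orderPred_of_analyticRank_six` / `_of_BSD`: the TIGHT load-bearing lemma —
    `V.analyticRank + 1 = [F:ℚ]` ("order exactly one short") does not give `[F:ℚ]` points — modulo
    `r_an(E₆) = 1` (GZ numerics `L'(E₆,1) ≠ 0`, ⇐ BSD at `E₆`, rank `1` certified); its unconditional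
    shadow is (A)'s `plecticPointsLB_false_of_weakVanishing`. WHY only modulo: no positive analytic rank is
    kernel-certifiable in the tree (an upper bound on `ord` is the non-vanishing of a DERIVATIVE; only
    `L(E_n,1)` itself is evaluated exactly, for `n ≤ 10`), so every exact-regime witness hangs on one
    Gross–Zagier-type numerical fact — recorded as the hypothesis, never as an axiom.
* **(G) Calibration at `d = 2` (gen 2).** `rank_two_le_of_plecticPointsLB`: the crux applied to a silent
  quadratic base change IS the summit's lower bound at analytic rank two — `r_an(W) = 2`, `K` real quadratic
  with `r_an(W^{(d_K)}) = 0 = rank W^{(d_K)}` (Kolyvagin, item RankLeOne) ⇒ `2 ≤ rank W(ℚ)` — and at `d = 2`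
  NO Kato descent (item KatoDescent, XL) is needed: `rank W(K) = rank W + rank W^{(d_K)}` is elementary
  (`mordellWeilRank_baseChange_of_finrank_eq_two_of_finite`). Planner note: KatoDescent is dischargeable from
  tree theorems in degree `2`; the crux itself is ≥ summit-LB(2)-hard on every instance `closes` uses.
* **(H) Lines (gen 2 boundary notes).** `sketch-conjugate-pigeonhole` (picked): DEAD at T, kernel-checked
  by the lead in `Cruxes/PlecticPointsLB/AtlasTightness.lean` (`plecticPointsLB_of_stub_atlas'`: T ⇒ crux;
  `stub_atlas_of_plecticPointsLB`: crux ⇒ T on entire-`L` curves; `exists_vanishing_factorisation`: T's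
  factorisation clauses are free) — nothing left to attack; (D) stands (0/3 stubs false). `selmer_ladder`
  (registered, not picked; stubs A firstZero, B parity, C ladder, D points): every stub is a consequence of
  BSD over `F` + finiteness of `Ш(V/F)[p^∞]` at one admissible `p`, so none is refutable short of a BSD/Ш
  counterexample; their side condition `Adm` (`p ≥ 5`, `p ∤ d_F`, irreducible mod `p`, good ORDINARY above `p`)
  is ENGINE-only (dropping it leaves BSD/Ш-consequences: p-parity at every `p`, `corank ≥ 1 ⇐ r_an ≥ 1` at
  every `p`), hence no `stub_false_without_Adm` can exist; admissible primes exist for every `V` (CM: `p`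
  split in the CM field; non-CM: Serre + Chebotarev in `F^{gal}`), so D's `∃ p, Adm ∧ …` is not vacuous-false.
  The (F) witnesses say where each stub is TESTABLE: on `E₆/ℚ(√265)` and `E₁/ℚ(√265)` the Selmer coranks at
  `p = 2` are computable by the tree's descents (corank₂ = rank, `Ш[2]` trivial for these `E_n`), consistent.

## Computations (kit job j024213, PARI 2.15.4, attached to the item; deeper scan j024319 finished 2026-08-17T12:05Z,
rc 0, 4 artefacts, attached as `compute-j024319.json` — its table is NOT readable from the gen-2 jail (run/gate not
mounted, `kit compute fetch` refuses another seat's job), so it is not summarised here; a later seat with access should)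
(A) Consistency scan over `ℚ(√5), ℚ(√2), ℚ(√13), ℚ(√3)`, coefficient box `a₁,a₃ ∈ {0,1}`, `a₂ ∈ {−1,0,1}`,
`a₄,a₆ ∈ {c + c'ω : |c|,|c'| ≤ 2}` (7500 equations per field), classes with norm conductor `≤ 3000` and
`j ∉ ℚ` (non-base-change up to twist), root number `+1`, numerically `L(V/F,1) = 0` and `ord = 2 = d`:
`ℚ(√5)`: 83 classes kept, 2 candidates — `[1,0,1,−(√5+5)/2,0]` (norm conductor 2911, `L(1) ≈ −4·10⁻²¹`) and
`[1,1,0,−√5−2,0]` (norm 2929, `L(1) ≈ 9·10⁻²¹`) — BOTH with two Néron–Tate-independent `F`-points found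
(regulator minors 0.118, 0.479): rank `≥ 2 = d`, consistent; `ℚ(√2), ℚ(√13), ℚ(√3)`: no candidate in range.
0 unresolved. (Printed: Bober et al., ANTS X 2013, arXiv:1202.6612 §7 — all curves over `ℚ(√5)` of norm
conductor `≤ 1831`, the first rank-2 one having prime norm 1831, hence not a base change; BSD data consistent.)
(B) Satisfiability of the hypotheses on SILENT base changes (the configuration `closes` feeds in):
`d = 2`: `E = 389a1` (`ellanalyticrank = [2, 1.5186]`, `ellrank = [2,2]`, points `(−2,0), (4,8)`); the real
quadratic `ℚ(√m)`, `m ≤ 40` squarefree, with `r_an(E^{(d_F)}) = 0` are `m ∈ {5, 6, 7, 11, 13, 17, 19, 30, 35}` —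
there `r_an(E_F) = 2 = [F:ℚ]` and rank `E(F) ≥ 2`. `d = 3`: `E = 5077a1` (`r_an = 3`, `ellrank = [3,3]`); the
cubic character `χ` mod `p` has `L(E,χ,1) ≠ 0` for `p ∈ {7, 13, 31, 37, 61, 67, 79, 97, 103}` (silent totally
real cyclic cubic fields: `r_an(E_F) = 3 = [F:ℚ]`, rank `≥ 3`) and VANISHES numerically (`|L| ~ 10⁻²²` at 64 bits)
for `p ∈ {19, 43, 73, 109}` (those `F` leave the regime: `r_an(E_F) ≥ 5`). `d = 4`: `E = 234446a1` (`r_an = 4`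
numerically, `ellrank = [4,4]`): the order-4 twists mod 17 and 41 VANISH numerically (quadratic ones do not),
so no silent real cyclic quartic field of conductor `≤ 41` — recorded, not pursued (outside this crux).

## What resists and why (for the provers)
The crux is refutation-proof relative to BSD over totally real fields: (i) no junk satisfies `r_an = d ≥ 2`;
(ii) an honest counterexample needs a CERTIFIED exact order `d ≥ 2` — available only for base changes `E_F` of
curves with `r_an(E) ∈ {2, 3}` over silent fields, where `rank E(F) ≥ rank E(ℚ) = r_an(E)` is already known from
explicit points — together with a rank bound `< d`, i.e. a counterexample to BSD/ℚ itself; (iii) off base change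
the exact order is not finitely certifiable at all. Standing advice: do not spend effort on `IsTotallyReal` or
`2 ≤ d` as logical inputs (they are engine scaffolding); the one hypothesis every proof must open is
`ord_{s=1} L(V/F,s) = [F:ℚ] ≥ 2`, and (A) shows that even `ord ≥ 1` with everything else in place yields only
`[F:ℚ] − 1` points. Mechanism-level (not truth-level) obstruction on the route's OWN instances (silent
abelian base changes `E_F`): the localised rank-`r` determinant receptacle of plectic invariants vanishes
identically on `∧ʳ E(ℚ)` (`Literature.Barriers.BirchSwinnertonDyer.PlecticDeterminantOverQ`, proved; FG
Rem. 1.1, DF §3.8) — the statement survives there (it is summit-LB at rank `r` via ArtinBaseChange +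
KatoDescent; at `r = 2` via (G) with no Kato at all), the engine does not. Gen 2 adds: the bound `d` is SHARP
(F: `rank = d` attained in the weak regime unconditionally, in the exact regime modulo `r_an(E₂₆₅) = 2`), so no
proof strategy may aim at `d + 1` points; and the regime is non-empty unless BSD fails at `E₂₆₅`.
-/

set_option linter.dupNamespace false

noncomputable section

open scoped Classical

attribute [-instance] instDecidableEqQuadraticAlgebra

namespace Summit.BirchSwinnertonDyer.BirchSwinnertonDyer.Cruxes.PlecticPointsLB.Disproof

open Summit.BirchSwinnertonDyer.BirchSwinnertonDyer.Theses.PlecticLegs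
open Literature.NumberTheory.EllipticCurves WeierstrassCurve
open Literature.NumberTheory.QuadraticFields
open NumberField NumberField.InfinitePlace

/-! ## (A) Load-bearing analysis -/

/-- The crux with the analytic-rank hypothesis `V.analyticRank = [F:ℚ]` DROPPED:
"every elliptic curve over a totally real field of degree `d ≥ 2` has rank `≥ d`". [folklore] -/
def PlecticPointsLBWithoutAnalyticRank : Prop :=
  ∀ (F : Type) [Field F] [NumberField F] [NumberField.IsTotallyReal F] (V : WeierstrassCurve F)
    [V.IsElliptic], 2 ≤ Module.finrank ℚ F → Module.finrank ℚ F ≤ V.mordellWeilRank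

/-- The crux with `V.analyticRank = [F:ℚ]` WEAKENED to `V.analyticRank ≠ 0`, i.e. `L(V/F, 1) = 0`
with the ORDER of vanishing left free. [folklore] -/
def PlecticPointsLBWeakVanishing : Prop :=
  ∀ (F : Type) [Field F] [NumberField F] [NumberField.IsTotallyReal F] (V : WeierstrassCurve F)
    [V.IsElliptic], 2 ≤ Module.finrank ℚ F → V.analyticRank ≠ 0 →
      Module.finrank ℚ F ≤ V.mordellWeilRank

/-- Dropping the hypothesis is weaker than weakening it. [folklore] -/
theorem weakVanishing_of_withoutAnalyticRank (h : PlecticPointsLBWithoutAnalyticRank) :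
    PlecticPointsLBWeakVanishing :=
  fun F _ _ _ V _ hd _ ↦ h F V hd

/-- `ℚ(√41)` is totally real. [folklore] -/
instance : NumberField.IsTotallyReal Sqrt41.K :=
  nrComplexPlaces_eq_zero_iff.mp Sqrt41.places.2

/-- **Any proof must use the analytic-rank hypothesis**: witness `F = ℚ(√41)`, `V = 480a1`,
`rank_ℤ V(F) ≤ 1 < 2 = [F:ℚ]` (complete 2-descent over `ℚ(√41)` in tree,
`DokchitserDokchitser2011.mordellWeilRank_480a1_K41_le_one`). [folklore] -/
theorem plecticPointsLB_false_without_analyticRank : ¬ PlecticPointsLBWithoutAnalyticRank := by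
  intro h
  haveI := Literature.Barriers.BirchSwinnertonDyer.curve480a1.isElliptic_baseChange Sqrt41.K
  have h1 := h Sqrt41.K (Literature.Barriers.BirchSwinnertonDyer.curve480a1.baseChange Sqrt41.K)
    (by rw [Sqrt41.finrank_eq_two])
  have h2 := Literature.Barriers.BirchSwinnertonDyer.DokchitserDokchitser2011.mordellWeilRank_480a1_K41_le_one
  rw [Sqrt41.finrank_eq_two] at h1
  omega

/-! ### The real quadratic field `ℚ(√6)` -/

namespace Sqrt6

/-- `K = ℚ(√6)` as `ℚ[ω]/(ω² - 6)`. [folklore] -/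
abbrev K : Type := QuadraticAlgebra ℚ 6 0

/-- `6` is not a rational square (`v₃(r²)` is even, `v₃(6) = 1`). [folklore] -/
theorem sq_ne (r : ℚ) : r ^ 2 ≠ (6 : ℚ) + 0 * r := by
  rw [zero_mul, add_zero]
  intro h
  have hr : r ≠ 0 := by rintro rfl; norm_num at h
  haveI : Fact (Nat.Prime 3) := ⟨by norm_num⟩
  have h6 : padicValRat 3 (6 : ℚ) = 1 := by
    rw [show (6 : ℚ) = ((2 : ℕ) : ℚ) * ((3 : ℕ) : ℚ) by norm_num,
      padicValRat.mul (by norm_num) (by norm_num), padicValRat.self (by norm_num),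
      padicValRat.of_nat, padicValNat.eq_zero_of_not_dvd (by norm_num)]
    norm_num
  have h1 : padicValRat 3 (r * r) = padicValRat 3 6 := by rw [← sq, h]
  rw [padicValRat.mul hr hr, h6] at h1
  omega

/-- `K` is a field. [folklore] -/
instance instFact : Fact (∀ r : ℚ, r ^ 2 ≠ (6 : ℚ) + 0 * r) := ⟨sq_ne⟩

/-- `K` is a number field. [folklore] -/
instance instNumberField : NumberField K := NumberField.mk

/-- `[K : ℚ] = 2`. [folklore] -/
theorem finrank_eq_two : Module.finrank ℚ K = 2 := by
  rw [Module.finrank_eq_card_basis (QuadraticAlgebra.basis (6 : ℚ) 0), Fintype.card_fin]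

/-- `θ = √6`. [folklore] -/
def θ : K := ⟨0, 1⟩

/-- `θ² = 6`. [folklore] -/
theorem θ_sq : θ ^ 2 = algebraMap ℚ K 6 := by
  rw [Algebra.algebraMap_eq_smul_one]
  ext <;> simp [θ, sq, QuadraticAlgebra.re_ofNat, QuadraticAlgebra.im_ofNat]

/-- `θ ∉ ℚ`. [folklore] -/
theorem θ_not_mem_range : θ ∉ Set.range (algebraMap ℚ K) := by
  rintro ⟨q, hq⟩
  have := congrArg QuadraticAlgebra.im hq
  simp [θ] at this

/-- `d_K = 6 q²` for a non-zero rational `q`. [folklore] -/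
theorem exists_discr : ∃ q : ℚ, q ≠ 0 ∧ (NumberField.discr K : ℚ) = 6 * q ^ 2 :=
  NumberField.exists_discr_eq_mul_sq finrank_eq_two θ_not_mem_range θ_sq

/-- `0 < d_K`. [folklore] -/
theorem discr_pos : 0 < NumberField.discr K := by
  obtain ⟨q, hq, h⟩ := exists_discr
  have : (0 : ℚ) < NumberField.discr K := by rw [h]; positivity
  exact_mod_cast this

/-- `ℚ(√6)` is totally real. [folklore] -/
instance : NumberField.IsTotallyReal K :=
  nrComplexPlaces_eq_zero_iff.mp
    (Quadratic.nrRealPlaces_eq_two_and_nrComplexPlaces_eq_zero finrank_eq_two discr_pos).2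

end Sqrt6

/-- `E_1^{(6)} = E_6` as Weierstrass equations. [folklore] -/
theorem quadraticTwist_congruentNumberCurve_one_six :
    (congruentNumberCurve 1).quadraticTwist 6 = congruentNumberCurve 6 := by
  ext <;> norm_num [quadraticTwist, congruentNumberCurve, b₂, b₄, b₆]

/-- **Vanishing at `s = 1` alone is not enough: the EXACT order `[F:ℚ]` is load-bearing.**
Witness `F = ℚ(√6)`, `V = E_1 : y² = x³ - x` over `F`: `L(V/F, s) = L(E_1, s) L(E_6, s)` vanishes
at `1` (`L(E_6, 1) = 0`, root number; in tree) so `r_an(V/F) ≠ 0`, yet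
`rank V(F) = rank E_1(ℚ) + rank E_6(ℚ) = 0 + 1 = 1 < 2` (complete 2-descents in tree). [folklore] -/
theorem plecticPointsLB_false_of_weakVanishing : ¬ PlecticPointsLBWeakVanishing := by
  intro h
  haveI hE1 : (congruentNumberCurve 1).IsElliptic := isElliptic_congruentNumberCurve one_ne_zero
  haveI hE6 : (congruentNumberCurve 6).IsElliptic := isElliptic_congruentNumberCurve (by norm_num)
  haveI : ((congruentNumberCurve 1).baseChange Sqrt6.K).IsElliptic :=
    inferInstanceAs ((congruentNumberCurve 1).map (algebraMap ℚ Sqrt6.K)).IsElliptic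
  obtain ⟨q, hq, hd⟩ := Sqrt6.exists_discr
  obtain ⟨C, hC⟩ := (congruentNumberCurve 1).exists_variableChange_quadraticTwist_mul_sq (6 : ℚ) q hq
  have hdisc : (congruentNumberCurve 1).quadraticTwist (NumberField.discr Sqrt6.K : ℚ) =
      C • congruentNumberCurve 6 := by
    rw [hd, ← hC, quadraticTwist_congruentNumberCurve_one_six]
  have hsq6 : Squarefree 6 := by
    rw [show (6 : ℕ) = 2 * 3 from rfl, Nat.squarefree_mul (by norm_num)]
    exact ⟨Nat.prime_two.prime.squarefree, Nat.prime_three.prime.squarefree⟩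
  have hE6ent : (congruentNumberCurve 6).HasEntireLFunction :=
    hasEntireLFunction_congruentNumberCurve_holds hsq6
  have hW : (congruentNumberCurve 1).HasEntireLFunction :=
    hasEntireLFunction_congruentNumberCurve_holds squarefree_one
  have hWd : ((congruentNumberCurve 1).quadraticTwist
      (NumberField.discr Sqrt6.K : ℚ)).HasEntireLFunction := by
    rw [hdisc]; exact (hasEntireLFunction_smul_iff _ C).mpr hE6ent
  -- analytic side: r_an(V/F) = r_an(E_1) + r_an(E_6) ≠ 0
  have hran := (congruentNumberCurve 1).analyticRankOver_eq_add_of_finrank_eq_two Sqrt6.K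
    Sqrt6.finrank_eq_two hW hWd
  have h6 : (congruentNumberCurve 6).analyticRank ≠ 0 :=
    analyticRank_ne_zero_of_entireLFunction_one_eq_zero _ hE6ent
      (entireLFunction_congruentNumberCurve_one_eq_zero_of_mod_eight hsq6 (by norm_num))
  have hne : ((congruentNumberCurve 1).baseChange Sqrt6.K).analyticRank ≠ 0 := by
    change (congruentNumberCurve 1).analyticRankOver Sqrt6.K ≠ 0
    rw [hran, hdisc, analyticRank_smul]
    omega
  -- arithmetic side: rank V(F) = rank E_1(ℚ) + rank E_6(ℚ) = 0 + 1
  haveI : Module.Finite ℤ ((congruentNumberCurve 1).baseChange Sqrt6.K).toAffine.Point :=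
    module_finite_point_holds _
  have hrk := (congruentNumberCurve 1).mordellWeilRank_baseChange_of_finrank_eq_two_of_finite
    Sqrt6.K Sqrt6.finrank_eq_two
  have hr6 : ((congruentNumberCurve 1).quadraticTwist
      (NumberField.discr Sqrt6.K : ℚ)).mordellWeilRank = 1 := by
    rw [hdisc]
    exact (mordellWeilRank_variableChange_holds _ C).trans
      Literature.Barriers.BirchSwinnertonDyer.CongruentDescent.E6.mordellWeilRank_eq
  have hr1 : (congruentNumberCurve 1).mordellWeilRank = 0 :=
    Literature.Barriers.BirchSwinnertonDyer.CongruentDescent.E1.mordellWeilRank_eq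
  have h1 := h Sqrt6.K ((congruentNumberCurve 1).baseChange Sqrt6.K)
    (by rw [Sqrt6.finrank_eq_two]) hne
  rw [Sqrt6.finrank_eq_two, hrk, hr1, hr6] at h1
  omega

/-! ## (D) Targets — stubs of the picked line `conjugate-pigeonhole` -/

/-- Mutation record for stub A (`stub_factorOrders`): at `d = 0` its conclusion quantifies over `Fin 0` and
holds vacuously, so the hypothesis `0 < d` is decoration (it is only used by the composition
`PlecticPointsLB_of`, where `d = [F:ℚ] ≥ 2` anyway). [folklore] -/
theorem stub_factorOrders_vacuous_at_zero (g : Fin 0 → ℂ → ℂ) :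
    ∀ i : Fin 0, analyticOrderAt (g i) 1 = 1 :=
  fun i ↦ i.elim0

/-! ## (F) Tightness of the bound and inhabitation of the regime (gen 2)

Landing as `Theorems/PlecticPointsLB/Negative/PlecticPointsLBTightness.lean` (namespace
`…Theorems.PlecticPointsLBNegative`, same theorem names); kept here verbatim so that the work-file is self-contained. -/

open Literature.Barriers.BirchSwinnertonDyer

/-- **The real quadratic field of discriminant `265`** (`265 = 5·53 ≡ 1 (mod 4)` square-free is
fundamental; totally real since `d_K > 0`). [folklore] -/
theorem exists_realQuadratic_discr_265 :
    ∃ (K : Type) (_ : Field K) (_ : NumberField K), NumberField.IsTotallyReal K ∧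
      Module.finrank ℚ K = 2 ∧ NumberField.discr K = 265 := by
  obtain ⟨K, _, _, h2, hdK⟩ :=
    Quadratic.exists_numberField_discr_eq (D := 265)
      (Or.inl ⟨by norm_num, by
        rw [← Int.squarefree_natAbs, show (265 : ℤ).natAbs = 5 * 53 by norm_num,
          Nat.squarefree_mul (by norm_num)]
        exact ⟨Nat.prime_five.prime.squarefree, (by norm_num : Nat.Prime 53).prime.squarefree⟩,
        by norm_num⟩)
  refine ⟨K, inferInstance, inferInstance, ?_, h2, hdK⟩
  have hpos : 0 < NumberField.discr K := by rw [hdK]; norm_num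
  exact nrComplexPlaces_eq_zero_iff.mp
    (Quadratic.nrRealPlaces_eq_two_and_nrComplexPlaces_eq_zero h2 hpos).2

/-- `E₆^{(265)} = E₁₅₉₀` as Weierstrass equations (`6 · 265 = 1590`). [folklore] -/
theorem quadraticTwist_congruentNumberCurve_six_265 :
    (congruentNumberCurve 6).quadraticTwist 265 = congruentNumberCurve 1590 := by
  ext <;> norm_num [quadraticTwist, congruentNumberCurve, b₂, b₄, b₆]

/-- `E₁^{(265)} = E₂₆₅` as Weierstrass equations. [folklore] -/
theorem quadraticTwist_congruentNumberCurve_one_265 :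
    (congruentNumberCurve 1).quadraticTwist 265 = congruentNumberCurve 265 := by
  ext <;> norm_num [quadraticTwist, congruentNumberCurve, b₂, b₄, b₆]

/-- `6` is square-free. [folklore] -/
theorem squarefree_six : Squarefree 6 := by
  rw [show (6 : ℕ) = 2 * 3 from rfl, Nat.squarefree_mul (by norm_num)]
  exact ⟨Nat.prime_two.prime.squarefree, Nat.prime_three.prime.squarefree⟩

/-- `265 = 5 · 53` is square-free. [folklore] -/
theorem squarefree_265 : Squarefree 265 := by
  rw [show (265 : ℕ) = 5 * 53 from rfl, Nat.squarefree_mul (by norm_num)]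
  exact ⟨Nat.prime_five.prime.squarefree, (by norm_num : Nat.Prime 53).prime.squarefree⟩

/-- `1590 = 2 · 3 · 5 · 53` is square-free. [folklore] -/
theorem squarefree_1590 : Squarefree 1590 := by
  rw [show (1590 : ℕ) = 6 * 265 from rfl, Nat.squarefree_mul (by norm_num)]
  exact ⟨squarefree_six, squarefree_265⟩

/-- **`r_an(E₁) = 0`**: `L(E₁, 1) = β/4 ≠ 0` (Birch–Swinnerton-Dyer 1965, in tree as
`entireLFunction_congruentNumberCurve_one_one_ne_zero`; also `Theorems.PinchPrime.Negative.
analyticRank_congruentNumberCurve_one`, re-derived here to keep this work-file's cone small). [cite: BirchSwinnertonDyer1965] -/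
theorem analyticRank_congruentNumberCurve_one_eq_zero : (congruentNumberCurve 1).analyticRank = 0 := by
  have h0 : analyticOrderAt (congruentNumberCurve 1).entireLFunction 1 = 0 :=
    analyticOrderAt_eq_zero.mpr (Or.inr entireLFunction_congruentNumberCurve_one_one_ne_zero)
  unfold WeierstrassCurve.analyticRank analyticOrderNatAt
  rw [h0]
  rfl

/-- `r_an(E_n) ≠ 0` for square-free `n ≡ 5, 6, 7 (mod 8)` (root number `−1`: `L(E_n, 1) = 0`;
Koblitz, Ch. II §5). [cite: KoblitzECMF1993, Ch. II §5, Theorem (p. 84)] -/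
theorem analyticRank_congruentNumberCurve_ne_zero_of_mod_eight {n : ℕ} (hsq : Squarefree n)
    (h8 : n % 8 = 5 ∨ n % 8 = 6 ∨ n % 8 = 7) : (congruentNumberCurve n).analyticRank ≠ 0 := by
  haveI := isElliptic_congruentNumberCurve hsq.ne_zero
  exact analyticRank_ne_zero_of_entireLFunction_one_eq_zero _
    (hasEntireLFunction_congruentNumberCurve_holds hsq)
    (entireLFunction_congruentNumberCurve_one_eq_zero_of_mod_eight hsq h8)

/-! ### (F.1) The weak regime `ord ≥ [F:ℚ]` is inhabited with `rank = [F:ℚ]` (balanced chart) -/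

/-- **`E₆ / ℚ(√265)`: `[K:ℚ] = 2 ≤ r_an(E₆/K)` and `rank_ℤ E₆(K) = 2`**, unconditionally.
`L(E₆/K, s) = L(E₆, s) L(E₁₅₉₀, s)` (Artin formalism, `d_K = 265`, `E₆^{(265)} = E₁₅₉₀`), both
factors vanish at `1` (`6 ≡ 1590 ≡ 6 (mod 8)`), so `r_an ≥ 2`; `rank E₆(K) = rank E₆(ℚ) +
rank E₁₅₉₀(ℚ) = 1 + 1` (complete `2`-descents). On paper both orders are exactly `1`, i.e. this
is a genuine (balanced) instance of the plectic regime with `rank = [K:ℚ]`. [folklore] -/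
theorem exists_weakRegime_rank_eq_degree :
    ∃ (F : Type) (_ : Field F) (_ : NumberField F) (_ : NumberField.IsTotallyReal F)
      (V : WeierstrassCurve F) (_ : V.IsElliptic),
      Module.finrank ℚ F = 2 ∧ 2 ≤ V.analyticRank ∧ V.mordellWeilRank = 2 := by
  obtain ⟨K, _, _, hK, h2, hdK⟩ := exists_realQuadratic_discr_265
  haveI := hK
  haveI hE6 : (congruentNumberCurve 6).IsElliptic := isElliptic_congruentNumberCurve (by norm_num)
  haveI : ((congruentNumberCurve 6).baseChange K).IsElliptic :=
    inferInstanceAs ((congruentNumberCurve 6).map (algebraMap ℚ K)).IsElliptic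
  have hdisc : (congruentNumberCurve 6).quadraticTwist (NumberField.discr K : ℚ) =
      congruentNumberCurve 1590 := by
    rw [hdK]; push_cast; exact quadraticTwist_congruentNumberCurve_six_265
  -- analytic side
  have hE6ent : (congruentNumberCurve 6).HasEntireLFunction :=
    hasEntireLFunction_congruentNumberCurve_holds squarefree_six
  have hWd : ((congruentNumberCurve 6).quadraticTwist
      (NumberField.discr K : ℚ)).HasEntireLFunction := by
    rw [hdisc]; exact hasEntireLFunction_congruentNumberCurve_holds squarefree_1590
  have hran := (congruentNumberCurve 6).analyticRankOver_eq_add_of_finrank_eq_two K h2 hE6ent hWd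
  have h6 := analyticRank_congruentNumberCurve_ne_zero_of_mod_eight squarefree_six
    (Or.inr (Or.inl (by norm_num)))
  have h1590 := analyticRank_congruentNumberCurve_ne_zero_of_mod_eight squarefree_1590
    (Or.inr (Or.inl (by norm_num)))
  have han : 2 ≤ ((congruentNumberCurve 6).baseChange K).analyticRank := by
    change 2 ≤ (congruentNumberCurve 6).analyticRankOver K
    rw [hran, hdisc]
    omega
  -- arithmetic side
  haveI : Module.Finite ℤ ((congruentNumberCurve 6).baseChange K).toAffine.Point :=
    module_finite_point_holds _
  have hrk := (congruentNumberCurve 6).mordellWeilRank_baseChange_of_finrank_eq_two_of_finite K h2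
  rw [hdisc, CongruentDescent.E6.mordellWeilRank_eq, CongruentDescent.E1590.mordellWeilRank_eq] at hrk
  exact ⟨K, inferInstance, inferInstance, hK, (congruentNumberCurve 6).baseChange K, inferInstance,
    h2, han, hrk⟩

/-- **The bound `[F:ℚ] ≤ rank` is sharp on the weak regime (unconditional tightness).** The
strengthening of `PlecticPointsLB` that weakens the hypothesis to `[F:ℚ] ≤ r_an(V/F)` (harmless
under BSD) and asks for ONE MORE point, `[F:ℚ] < rank_ℤ V(F)`, is false: `E₆/ℚ(√265)` has
`r_an ≥ 2 = [F:ℚ]` and rank exactly `2`. [folklore] -/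
theorem plecticPointsLB_bound_not_strict_weak :
    ¬ (∀ (F : Type) [Field F] [NumberField F] [NumberField.IsTotallyReal F]
        (V : WeierstrassCurve F) [V.IsElliptic],
        2 ≤ Module.finrank ℚ F → Module.finrank ℚ F ≤ V.analyticRank →
          Module.finrank ℚ F < V.mordellWeilRank) := by
  intro h
  obtain ⟨F, _, _, _, V, _, h2, han, hrk⟩ := exists_weakRegime_rank_eq_degree
  have := h F V (by omega) (by omega)
  omega

/-! ### (F.2) The route's own configuration: a silent base change of a rank-two curve -/

/-- **`E₁ / ℚ(√265)`: rank `2 = [K:ℚ]` and `r_an(E₁/K) = r_an(E₂₆₅)` exactly.**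
`L(E₁/K, s) = L(E₁, s) L(E₂₆₅, s)` with `L(E₁, 1) ≠ 0` (`r_an(E₁) = 0`), and
`rank E₁(K) = rank E₁(ℚ) + rank E₂₆₅(ℚ) = 0 + 2`. This is the configuration the route's `closes`
feeds into the crux (an unbalanced, "silent" real quadratic base change of a rank-two curve over
`ℚ`, factor orders `(r_an(E₂₆₅), 0)`), with every quantity except `r_an(E₂₆₅)` kernel-certified.
[folklore] -/
theorem exists_silentBaseChange_rank_eq_degree :
    ∃ (F : Type) (_ : Field F) (_ : NumberField F) (_ : NumberField.IsTotallyReal F)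
      (V : WeierstrassCurve F) (_ : V.IsElliptic),
      Module.finrank ℚ F = 2 ∧ V.analyticRank = (congruentNumberCurve 265).analyticRank ∧
        V.mordellWeilRank = 2 := by
  obtain ⟨K, _, _, hK, h2, hdK⟩ := exists_realQuadratic_discr_265
  haveI := hK
  haveI hE1 : (congruentNumberCurve 1).IsElliptic := isElliptic_congruentNumberCurve one_ne_zero
  haveI : ((congruentNumberCurve 1).baseChange K).IsElliptic :=
    inferInstanceAs ((congruentNumberCurve 1).map (algebraMap ℚ K)).IsElliptic
  have hdisc : (congruentNumberCurve 1).quadraticTwist (NumberField.discr K : ℚ) =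
      congruentNumberCurve 265 := by
    rw [hdK]; push_cast; exact quadraticTwist_congruentNumberCurve_one_265
  -- analytic side
  have hE1ent : (congruentNumberCurve 1).HasEntireLFunction :=
    hasEntireLFunction_congruentNumberCurve_holds squarefree_one
  have hWd : ((congruentNumberCurve 1).quadraticTwist
      (NumberField.discr K : ℚ)).HasEntireLFunction := by
    rw [hdisc]; exact hasEntireLFunction_congruentNumberCurve_holds squarefree_265
  have hran := (congruentNumberCurve 1).analyticRankOver_eq_add_of_finrank_eq_two K h2 hE1ent hWd
  have han : ((congruentNumberCurve 1).baseChange K).analyticRank =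
      (congruentNumberCurve 265).analyticRank := by
    change (congruentNumberCurve 1).analyticRankOver K = _
    rw [hran, hdisc, analyticRank_congruentNumberCurve_one_eq_zero, zero_add]
  -- arithmetic side
  haveI : Module.Finite ℤ ((congruentNumberCurve 1).baseChange K).toAffine.Point :=
    module_finite_point_holds _
  have hrk := (congruentNumberCurve 1).mordellWeilRank_baseChange_of_finrank_eq_two_of_finite K h2
  rw [hdisc, CongruentDescent.E1.mordellWeilRank_eq, CongruentDescent.E265.mordellWeilRank_eq] at hrk
  exact ⟨K, inferInstance, inferInstance, hK, (congruentNumberCurve 1).baseChange K, inferInstance,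
    h2, han, hrk⟩

/-- **The exact regime is inhabited, with `rank = [F:ℚ]`, as soon as `r_an(E₂₆₅) = 2`** (the
printed numerical fact `L(E₂₆₅,1) = L'(E₂₆₅,1) = 0 ≠ L''(E₂₆₅,1)`, consistent with BSD at the
rank-two curve `E₂₆₅`; NOT certifiable in the tree, where no positive analytic rank is known
exactly). Witness `E₁/ℚ(√265)`. [folklore] -/
theorem regime_inhabited_rank_eq_of_analyticRank_265
    (h265 : (congruentNumberCurve 265).analyticRank = 2) :
    ∃ (F : Type) (_ : Field F) (_ : NumberField F) (_ : NumberField.IsTotallyReal F)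
      (V : WeierstrassCurve F) (_ : V.IsElliptic),
      2 ≤ Module.finrank ℚ F ∧ V.analyticRank = Module.finrank ℚ F ∧
        V.mordellWeilRank = Module.finrank ℚ F := by
  obtain ⟨F, _, _, _, V, _, h2, han, hrk⟩ := exists_silentBaseChange_rank_eq_degree
  exact ⟨F, inferInstance, inferInstance, inferInstance, V, inferInstance, by omega,
    by rw [han, h265, h2], by rw [hrk, h2]⟩

/-- **Non-vacuity of the crux modulo the summit at ONE curve.** If BSD(RANK) holds (it suffices
that it holds for `E₂₆₅`, whose rank `2` is certified), the hypotheses of `PlecticPointsLB` are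
satisfiable at `d = 2` by an instance with `rank = d`; contrapositively, were the plectic regime
empty on quadratic base changes, BSD would fail at `E₂₆₅`. [folklore] -/
theorem regime_inhabited_rank_eq_of_BSD (hBSD : _root_.BirchSwinnertonDyer) :
    ∃ (F : Type) (_ : Field F) (_ : NumberField F) (_ : NumberField.IsTotallyReal F)
      (V : WeierstrassCurve F) (_ : V.IsElliptic),
      2 ≤ Module.finrank ℚ F ∧ V.analyticRank = Module.finrank ℚ F ∧
        V.mordellWeilRank = Module.finrank ℚ F := by
  haveI : (congruentNumberCurve 265).IsElliptic := isElliptic_congruentNumberCurve (by norm_num)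
  have h := hBSD (congruentNumberCurve 265) inferInstance
  rw [CongruentDescent.E265.mordellWeilRank_eq] at h
  exact regime_inhabited_rank_eq_of_analyticRank_265 h

/-- **Tightness of the EXACT crux modulo `r_an(E₂₆₅) = 2`**: the conclusion `[F:ℚ] ≤ rank` of
`PlecticPointsLB` cannot be strengthened to `[F:ℚ] < rank` (witness `E₁/ℚ(√265)`, rank `2`).
[folklore] -/
theorem plecticPointsLB_bound_not_strict_of_analyticRank_265
    (h265 : (congruentNumberCurve 265).analyticRank = 2) :
    ¬ (∀ (F : Type) [Field F] [NumberField F] [NumberField.IsTotallyReal F]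
        (V : WeierstrassCurve F) [V.IsElliptic],
        2 ≤ Module.finrank ℚ F → V.analyticRank = Module.finrank ℚ F →
          Module.finrank ℚ F < V.mordellWeilRank) := by
  intro h
  obtain ⟨F, _, _, _, V, _, h2, han, hrk⟩ := regime_inhabited_rank_eq_of_analyticRank_265 h265
  have := h F V h2 han
  omega

/-! ### (F.3) The tight load-bearing lemma: order exactly `[F:ℚ] − 1` is not enough -/

/-- **`PlecticPointsLB` with `V.analyticRank = [F:ℚ]` replaced by `V.analyticRank + 1 = [F:ℚ]`
("the L-function vanishes to order exactly one less than the degree") is false, given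
`r_an(E₆) = 1`** (Gross–Zagier numerics `L'(E₆, 1) ≠ 0`; BSD-consistent with the certified
`rank E₆(ℚ) = 1`). Witness `F = ℚ(√6)` (discriminant `24`), `V = E₁/F`:
`r_an(V/F) = r_an(E₁) + r_an(E₆) = 0 + 1 = [F:ℚ] − 1`, `rank V(F) = 0 + 1 = 1 < 2`. The
unconditional shadow of this lemma (`r_an(E₆) ≠ 0` only) is
`plecticPointsLB_false_without_exactOrder`. [cite: SilvermanAEC2009, Exercise 10.16 and Prop. X.1.4] -/
theorem plecticPointsLB_false_at_orderPred_of_analyticRank_six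
    (h6 : (congruentNumberCurve 6).analyticRank = 1) :
    ¬ (∀ (F : Type) [Field F] [NumberField F] [NumberField.IsTotallyReal F]
        (V : WeierstrassCurve F) [V.IsElliptic],
        2 ≤ Module.finrank ℚ F → V.analyticRank + 1 = Module.finrank ℚ F →
          Module.finrank ℚ F ≤ V.mordellWeilRank) := by
  intro h
  -- the real quadratic field of discriminant `24 = 4·6`, i.e. `ℚ(√6)`
  obtain ⟨K, _, _, h2, hdK⟩ :=
    Quadratic.exists_numberField_discr_eq (D := 24)
      (Or.inr ⟨by norm_num, Or.inl (by norm_num), by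
        rw [← Int.squarefree_natAbs, show ((24 : ℤ) / 4).natAbs = 2 * 3 by norm_num,
          Nat.squarefree_mul (by norm_num)]
        exact ⟨Nat.prime_two.prime.squarefree, Nat.prime_three.prime.squarefree⟩⟩)
  haveI : NumberField.IsTotallyReal K := by
    have hpos : 0 < NumberField.discr K := by rw [hdK]; norm_num
    exact nrComplexPlaces_eq_zero_iff.mp
      (Quadratic.nrRealPlaces_eq_two_and_nrComplexPlaces_eq_zero h2 hpos).2
  haveI hE1 : (congruentNumberCurve 1).IsElliptic := isElliptic_congruentNumberCurve one_ne_zero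
  haveI hE6 : (congruentNumberCurve 6).IsElliptic := isElliptic_congruentNumberCurve (by norm_num)
  haveI : ((congruentNumberCurve 1).baseChange K).IsElliptic :=
    inferInstanceAs ((congruentNumberCurve 1).map (algebraMap ℚ K)).IsElliptic
  -- `E₁^{(d_K)} = E₁^{(6·2²)} ≅ E₁^{(6)} = E₆`
  have htw : (congruentNumberCurve 1).quadraticTwist 6 = congruentNumberCurve 6 := by
    ext <;> norm_num [quadraticTwist, congruentNumberCurve, b₂, b₄, b₆]
  obtain ⟨C, hC⟩ :=
    (congruentNumberCurve 1).exists_variableChange_quadraticTwist_mul_sq (6 : ℚ) 2 two_ne_zero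
  have hdisc : (congruentNumberCurve 1).quadraticTwist (NumberField.discr K : ℚ) =
      C • congruentNumberCurve 6 := by
    rw [hdK, ← htw, hC]
    push_cast
    norm_num
  have hE6ent : (congruentNumberCurve 6).HasEntireLFunction :=
    hasEntireLFunction_congruentNumberCurve_holds squarefree_six
  have hW : (congruentNumberCurve 1).HasEntireLFunction :=
    hasEntireLFunction_congruentNumberCurve_holds squarefree_one
  have hWd : ((congruentNumberCurve 1).quadraticTwist
      (NumberField.discr K : ℚ)).HasEntireLFunction := by
    rw [hdisc]; exact (hasEntireLFunction_smul_iff _ C).mpr hE6ent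
  -- analytic side: `r_an(V/F) = r_an(E₁) + r_an(E₆) = 0 + 1`
  have hran := (congruentNumberCurve 1).analyticRankOver_eq_add_of_finrank_eq_two K h2 hW hWd
  have han : ((congruentNumberCurve 1).baseChange K).analyticRank + 1 = Module.finrank ℚ K := by
    change (congruentNumberCurve 1).analyticRankOver K + 1 = _
    rw [hran, hdisc, analyticRank_smul, analyticRank_congruentNumberCurve_one_eq_zero, h6, h2]
  -- arithmetic side: `rank V(F) = rank E₁(ℚ) + rank E₆(ℚ) = 0 + 1`
  haveI : Module.Finite ℤ ((congruentNumberCurve 1).baseChange K).toAffine.Point :=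
    module_finite_point_holds _
  have hrk := (congruentNumberCurve 1).mordellWeilRank_baseChange_of_finrank_eq_two_of_finite K h2
  have hr6 : ((congruentNumberCurve 1).quadraticTwist
      (NumberField.discr K : ℚ)).mordellWeilRank = 1 := by
    rw [hdisc]
    exact (mordellWeilRank_variableChange_holds _ C).trans CongruentDescent.E6.mordellWeilRank_eq
  have h1 := h K ((congruentNumberCurve 1).baseChange K) (by omega) han
  rw [h2, hrk, CongruentDescent.E1.mordellWeilRank_eq, hr6] at h1
  omega

/-- The same modulo the summit: BSD(RANK) at `E₆` (rank `1` certified) gives `r_an(E₆) = 1`.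
[folklore] -/
theorem plecticPointsLB_false_at_orderPred_of_BSD (hBSD : _root_.BirchSwinnertonDyer) :
    ¬ (∀ (F : Type) [Field F] [NumberField F] [NumberField.IsTotallyReal F]
        (V : WeierstrassCurve F) [V.IsElliptic],
        2 ≤ Module.finrank ℚ F → V.analyticRank + 1 = Module.finrank ℚ F →
          Module.finrank ℚ F ≤ V.mordellWeilRank) := by
  haveI : (congruentNumberCurve 6).IsElliptic := isElliptic_congruentNumberCurve (by norm_num)
  have h := hBSD (congruentNumberCurve 6) inferInstance
  rw [CongruentDescent.E6.mordellWeilRank_eq] at h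
  exact plecticPointsLB_false_at_orderPred_of_analyticRank_six h

/-! ## (G) Calibration at `d = 2`: the crux delivers the summit's rank-two lower bound, Kato-free -/

/-- **At `d = 2` the crux is the rank-two lower bound over `ℚ` on curves with a silent real
quadratic twist.** Let `W/ℚ` be elliptic with `r_an(W) = 2`, `K` a totally real quadratic field
such that `L(W, s)` and `L(W^{(d_K)}, s)` have entire continuations, `r_an(W^{(d_K)}) = 0` and
`rank W^{(d_K)}(ℚ) = 0` (the last from the previous one by Kolyvagin/Kato — route item `RankLeOne`).
Then `PlecticPointsLB` yields `2 ≤ rank_ℤ W(ℚ)`: `r_an(W_K) = 2 + 0 = [K:ℚ]` by Artin formalism,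
the crux gives `2 ≤ rank W(K)`, and `rank W(K) = rank W(ℚ) + rank W^{(d_K)}(ℚ)` is elementary —
no Kato descent is needed in degree `2`. [folklore] -/
theorem rank_two_le_of_plecticPointsLB (h : PlecticPointsLB) (W : WeierstrassCurve ℚ) [W.IsElliptic]
    (K : Type) [Field K] [NumberField K] [NumberField.IsTotallyReal K]
    (h2 : Module.finrank ℚ K = 2) (hW : W.HasEntireLFunction)
    (hWd : (W.quadraticTwist (NumberField.discr K : ℚ)).HasEntireLFunction)
    (hran : W.analyticRank = 2) (hran' : (W.quadraticTwist (NumberField.discr K : ℚ)).analyticRank = 0)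
    (hrk' : (W.quadraticTwist (NumberField.discr K : ℚ)).mordellWeilRank = 0) :
    2 ≤ W.mordellWeilRank := by
  haveI : (W.baseChange K).IsElliptic := inferInstanceAs (W.map (algebraMap ℚ K)).IsElliptic
  have hK := W.analyticRankOver_eq_add_of_finrank_eq_two K h2 hW hWd
  have hV : (W.baseChange K).analyticRank = Module.finrank ℚ K := by
    change W.analyticRankOver K = _
    rw [hK, hran, hran', h2]
  have hle := h K (W.baseChange K) (by omega) hV
  haveI : Module.Finite ℤ (W.baseChange K).toAffine.Point := module_finite_point_holds _
  rw [h2, W.mordellWeilRank_baseChange_of_finrank_eq_two_of_finite K h2, hrk', add_zero] at hle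
  exact hle

/-! ## (E) Near-miss of v1–v2, discharged modulo `r_an(E₂₆₅) = 2` (gen 2) -/

/-- **The plectic regime is inhabited at `d = 2`** (so the crux is not vacuous) — v1–v2 recorded this as a
`sorry` (on paper: `389a1` over the silent real quadratic fields `ℚ(√m)`, `m ∈ {5,6,7,11,13,17,19,30,35}`, kit
j024213). v3: PROVED from the single printed numerical fact `r_an(E₂₆₅) = 2` (`L(E₂₆₅,1) = L'(E₂₆₅,1) = 0`,
`L''(E₂₆₅,1) ≠ 0`; ⇐ BSD(RANK) at `E₂₆₅`, rank `2` certified), by the silent base change `E₁/ℚ(√265)` of (F),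
which moreover has `rank = [F:ℚ]`. Obstruction to removing the hypothesis: no positive analytic rank is
kernel-certified in the tree (needs a certified non-vanishing DERIVATIVE of a Hecke L-function). [folklore] -/
theorem hypotheses_satisfiable_d2 (h265 : (congruentNumberCurve 265).analyticRank = 2) :
    ∃ (F : Type) (_ : Field F) (_ : NumberField F) (_ : NumberField.IsTotallyReal F)
      (V : WeierstrassCurve F) (_ : V.IsElliptic),
      2 ≤ Module.finrank ℚ F ∧ V.analyticRank = Module.finrank ℚ F := by
  obtain ⟨F, _, _, _, V, _, h2, han, -⟩ := regime_inhabited_rank_eq_of_analyticRank_265 h265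
  exact ⟨F, inferInstance, inferInstance, inferInstance, V, inferInstance, h2, han⟩

end Summit.BirchSwinnertonDyer.BirchSwinnertonDyer.Cruxes.PlecticPointsLB.Disproof

end
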